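import Summits.QuantumFields.BalabanUV.Beta.CapRows

/-!
# Beta / CapRowsTail — BINDER-OWNERS row CAP-k × the MONOTONICITY ∕ CONTRACTION-in-k route (gan24-p4): the ROW-SIDE SOCKETS
# (β sub-cell, DEDICATED row BETA-an5, lineage `b2b-balaban-beta-an5` = OWNER of row CAP-k; gen 19; coordinator notice 2026-08-19T22:17Z
# «beta-an5 / beta-cap-ref: agree decl names so your certified k₀ rows and p4's monotonicity statement meet in ONE Lean theorem (Beta/GAN24/Monotone.lean)»)

HONEST FRAMING (page 1 of everything the β sub-cell writes): discharging `BetaPertH` makes Bałaban's UV stability UNCONDITIONAL — a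
real constructive-QFT result; it is NOT the continuum limit and NOT the Clay problem.  HONEST DEPENDENCY (cell reorg 2026-08-19, verbatim):
«continuum YM on T⁴ ⇐ BetaPertH ∧ nine spine estimates (0/9 proved); BetaPertH ⇐ (D1) ∧ (D4) ∧ CAP+tail; G-an2-4 gates asym, D1 and NE2/3/4.»

THIS MODULE IS PLUMBING (the CONSUMER's sockets, pattern of asym1's `HessKerDressedUnitsWall`): it fixes the three hypothesis SHAPES in which a
monotonicity ∕ contraction statement about an abstract sequence `b` (intended `b = S.β0`, Bałaban's one-loop coefficients — nothing about that
family is asserted) meets the certified rows `CapRows.Rows b` of row CAP-k, and proves the FLOOR each combination yields and the (R15) carrier it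
feeds (`RemainderConstCertified.betaLowerH_of_floor_const` + `AveragedAFCarrier.betaAvgAFH_of_betaLowerH`).  The shapes are `def`s WITH PARAMETERS
(binder shapes, never facts); the producer (gan24-p4, `Beta/GAN24/Monotone.lean`) discharges one of them for the literal sequence and applies the
matching END below BY NAME — that application is the ONE meeting theorem the coordinator asks for.

 * `MonotoneTailUp b k₀`      : `∀ k ≥ k₀, b k ≤ b (k+1)`                      ⟹ floor `m₀` (rows alone; no limit value needed);
 * `MonotoneTailDown b k₀`    : `∀ k ≥ k₀, b (k+1) ≤ b k` + `Tendsto b atTop (𝓝 binf)` ⟹ floor `min m₀ binf` (rows serve `k ≤ k₀` only);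
 * `ContractingTail b binf θ k₀` : `∀ k ≥ k₀, |b (k+1) − binf| ≤ θ·|b k − binf|`, `0 ≤ θ ≤ 1`, + ONE two-sided datum `|b k₀ − binf| ≤ D`
                                 ⟹ floor `min m₀ (binf − θ·D)` — NO SHARP RATE: any `θ ≤ 1` works as soon as `θ·D < binf`
                                 (at the evidence-grade magnitudes of BETA/CERT.md, `D ≈ 0.253`, `binf ≈ 0.408`: floor `≥ 0.155` even at `θ = 1`);
   and `ContractingTail b binf θ 0` + `|b 0 − binf| ≤ D` IS `RateCertificate.GeomRate b binf D θ` with the TIGHT constant (`geomRate_of_contractingTail`) —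
   the case in which `CapRows` §4 shows the certified road's `hk₂` is satisfiable.

ABSOLUTE RULE (cell charter, verbatim): "No internally-minted statement may enter as a cited fact. Every hypothesis is either
kernel-proved in this package or a verbatim quotation of a PUBLISHED theorem with page reference. The manuscript(s) under audit are
NOT citable for their own disputed steps — they are the thing under adjudication; programme-internal (2001/route/tribunal) claims
are never citable."  Nothing is cited; 0 binders instantiated. [folklore]
-/

namespace Summit.QuantumFields.BalabanUV.Beta.CapRowsTail

open Filter Topology
open Literature.MathematicalPhysics.QuantumFieldTheory.Balaban1983to89
open Literature.MathematicalPhysics.QuantumFieldTheory.Balaban1983to89.Beta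
open FlowStep
open Beta.RemainderChain (RemainderConst)
open Beta.RateCertificate (GeomRate)
open Beta.AveragedAFCarrier (BetaAvgAFH betaAvgAFH_of_betaLowerH)
open Beta.RemainderConstCertified (betaLowerH_of_floor_const)
open Summit.QuantumFields.BalabanUV.Beta.CapRows

/-! ## §1 The three socket shapes (binder shapes with parameters; nothing asserted) -/

/-- SOCKET (M↑): the sequence is eventually non-decreasing from `k₀` on. [folklore] -/
def MonotoneTailUp (b : ℕ → ℝ) (k₀ : ℕ) : Prop := ∀ k, k₀ ≤ k → b k ≤ b (k + 1)

/-- SOCKET (M↓): the sequence is eventually non-increasing from `k₀` on. [folklore] -/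
def MonotoneTailDown (b : ℕ → ℝ) (k₀ : ℕ) : Prop := ∀ k, k₀ ≤ k → b (k + 1) ≤ b k

/-- SOCKET (C): contraction towards `binf` at ratio `θ` from `k₀` on: `|b (k+1) − binf| ≤ θ·|b k − binf|`. [folklore] -/
def ContractingTail (b : ℕ → ℝ) (binf θ : ℝ) (k₀ : ℕ) : Prop := ∀ k, k₀ ≤ k → |b (k + 1) - binf| ≤ θ * |b k - binf|

/-! ## §2 Floors -/

section Floors

variable {b : ℕ → ℝ}

/-- (M↑) propagates a value at `k₀` upward: `b k₀ ≤ b k` for `k ≥ k₀`. [folklore] -/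
theorem le_of_monotoneTailUp {k₀ : ℕ} (h : MonotoneTailUp b k₀) : ∀ k, k₀ ≤ k → b k₀ ≤ b k := by
  intro k hk
  induction k, hk using Nat.le_induction with
  | base => exact le_rfl
  | succ n hn ih => exact ih.trans (h n hn)

/-- (M↓) + a limit: `binf ≤ b k` for `k ≥ k₀` (a non-increasing tail stays above its limit). [folklore] -/
theorem limit_le_of_monotoneTailDown {k₀ : ℕ} {binf : ℝ} (h : MonotoneTailDown b k₀) (hlim : Tendsto b atTop (𝓝 binf)) :
    ∀ k, k₀ ≤ k → binf ≤ b k := by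
  intro k hk
  -- the shifted tail `j ↦ b (k + j)` is antitone and tends to `binf`
  have hanti : Antitone fun j : ℕ => b (k + j) := by
    refine antitone_nat_of_succ_le fun j => ?_
    show b (k + (j + 1)) ≤ b (k + j)
    rw [← Nat.add_assoc]
    exact h (k + j) (by omega)
  have hlim' : Tendsto (fun j : ℕ => b (k + j)) atTop (𝓝 binf) :=
    hlim.comp (tendsto_atTop_atTop.mpr fun n => ⟨n, fun j hj => by omega⟩)
  have := hanti.le_of_tendsto hlim' 0
  simpa using this

/-- (C) iterated: `|b k − binf| ≤ θ^{k−k₀}·|b k₀ − binf|` for `k ≥ k₀` (`0 ≤ θ`). [folklore] -/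
theorem abs_sub_le_of_contractingTail {k₀ : ℕ} {binf θ : ℝ} (h : ContractingTail b binf θ k₀) (hθ0 : 0 ≤ θ) :
    ∀ k, k₀ ≤ k → |b k - binf| ≤ θ ^ (k - k₀) * |b k₀ - binf| := by
  intro k hk
  induction k, hk using Nat.le_induction with
  | base => simp
  | succ n hn ih =>
    calc |b (n + 1) - binf| ≤ θ * |b n - binf| := h n hn
      _ ≤ θ * (θ ^ (n - k₀) * |b k₀ - binf|) := mul_le_mul_of_nonneg_left ih hθ0
      _ = θ ^ (n + 1 - k₀) * |b k₀ - binf| := by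
          rw [← mul_assoc, ← pow_succ', show n + 1 - k₀ = n - k₀ + 1 by omega]

/-- (C) with `0 ≤ θ ≤ 1` and ONE two-sided datum `|b k₀ − binf| ≤ D`: `binf − θ·D ≤ b k` for every `k > k₀` (and `binf − D ≤ b k₀`). [folklore] -/
theorem floor_tail_of_contractingTail {k₀ : ℕ} {binf θ D : ℝ} (h : ContractingTail b binf θ k₀) (hθ0 : 0 ≤ θ) (hθ1 : θ ≤ 1)
    (hD : |b k₀ - binf| ≤ D) : ∀ k, k₀ < k → binf - θ * D ≤ b k := by
  intro k hk
  have hD0 : 0 ≤ D := (abs_nonneg _).trans hD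
  have h1 := abs_sub_le_of_contractingTail h hθ0 k hk.le
  have hpow : θ ^ (k - k₀) ≤ θ := by
    calc θ ^ (k - k₀) = θ ^ (k - k₀ - 1) * θ := by rw [← pow_succ, show k - k₀ - 1 + 1 = k - k₀ by omega]
      _ ≤ 1 * θ := mul_le_mul_of_nonneg_right (pow_le_one₀ hθ0 hθ1) hθ0
      _ = θ := one_mul θ
  have h2 : |b k - binf| ≤ θ * D :=
    h1.trans (mul_le_mul hpow hD (abs_nonneg _) hθ0)
  have h3 := (abs_le.mp h2).1
  linarith

/-- the two-sided datum from rational enclosures: `lo ≤ b k₀ ≤ hi`, `bl ≤ binf ≤ bh` ⟹ `|b k₀ − binf| ≤ max (hi − bl) (bh − lo)`. [folklore] -/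
theorem abs_sub_le_of_enclosures {x binf lo hi bl bh : ℝ} (hlo : lo ≤ x) (hhi : x ≤ hi) (hbl : bl ≤ binf) (hbh : binf ≤ bh) :
    |x - binf| ≤ max (hi - bl) (bh - lo) := by
  rw [abs_le]
  constructor
  · have : -(max (hi - bl) (bh - lo)) ≤ -(bh - lo) := neg_le_neg (le_max_right _ _)
    linarith
  · exact le_trans (by linarith) (le_max_left _ _)

/-- (C) from `k₀ = 0` with the datum `|b 0 − binf| ≤ D` IS the asymptotic lane's rate shape with the TIGHT constant:
`GeomRate b binf D θ`. [folklore] -/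
theorem geomRate_of_contractingTail {binf θ D : ℝ} (h : ContractingTail b binf θ 0) (hθ0 : 0 ≤ θ) (hD : |b 0 - binf| ≤ D) :
    GeomRate b binf D θ := by
  intro k
  have h1 := abs_sub_le_of_contractingTail h hθ0 k (Nat.zero_le k)
  rw [Nat.sub_zero] at h1
  calc |b k - binf| ≤ θ ^ k * |b 0 - binf| := h1
    _ ≤ θ ^ k * D := mul_le_mul_of_nonneg_left hD (pow_nonneg hθ0 _)
    _ = D * θ ^ k := mul_comm _ _

/-! ### … met with the certified rows of `CapRows` -/

/-- **ROWS × (M↑)**: certified rows up to `k₀` and a non-decreasing tail from `k₀` ⟹ the floor `m₀ ≤ b k` for EVERY `k`. [folklore] -/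
theorem floor_of_rows_monotoneTailUp (c : Rows b) (h : MonotoneTailUp b c.k₀) : ∀ k, ((c.m₀ : ℚ) : ℝ) ≤ b k := by
  intro k
  rcases le_or_gt k c.k₀ with hk | hk
  · exact c.hsmall k (Nat.lt_succ_of_le hk)
  · exact (c.hsmall c.k₀ (Nat.lt_succ_self _)).trans (le_of_monotoneTailUp h k hk.le)

/-- **ROWS × (M↓ + limit)**: certified rows up to `k₀`, a non-increasing tail from `k₀` with limit `binf` ⟹ `min m₀ binf ≤ b k` for every `k`. [folklore] -/
theorem floor_of_rows_monotoneTailDown (c : Rows b) {binf : ℝ} (h : MonotoneTailDown b c.k₀) (hlim : Tendsto b atTop (𝓝 binf)) :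
    ∀ k, min ((c.m₀ : ℚ) : ℝ) binf ≤ b k := by
  intro k
  rcases le_or_gt k c.k₀ with hk | hk
  · exact (min_le_left _ _).trans (c.hsmall k (Nat.lt_succ_of_le hk))
  · exact (min_le_right _ _).trans (limit_le_of_monotoneTailDown h hlim k hk.le)

/-- **ROWS × (C)**: certified rows up to `k₀`, contraction from `k₀` at ratio `θ ∈ [0,1]` towards `binf`, and the datum `|b k₀ − binf| ≤ D` ⟹
`min m₀ (binf − θ·D) ≤ b k` for every `k` — no sharp rate needed. [folklore] -/
theorem floor_of_rows_contractingTail (c : Rows b) {binf θ D : ℝ} (h : ContractingTail b binf θ c.k₀) (hθ0 : 0 ≤ θ) (hθ1 : θ ≤ 1)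
    (hD : |b c.k₀ - binf| ≤ D) : ∀ k, min ((c.m₀ : ℚ) : ℝ) (binf - θ * D) ≤ b k := by
  intro k
  rcases le_or_gt k c.k₀ with hk | hk
  · exact (min_le_left _ _).trans (c.hsmall k (Nat.lt_succ_of_le hk))
  · exact (min_le_right _ _).trans (floor_tail_of_contractingTail h hθ0 hθ1 hD k hk)

end Floors

/-! ## §3 The ENDs: floor ⟹ the (R15) carrier `BetaAvgAFH (floor − r) 0 γ₀ β` (defect zero) -/

section Ends

variable {β : HBeta}

/-- **END (M↑)**: `OneLoopSplit S`, certified rows for `S.β0` up to `k₀`, `MonotoneTailUp S.β0 k₀`, constant remainder `RemainderConst S γ₀ r` ⟹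
`BetaAvgAFH (m₀ − r) 0 γ₀ β`.  The meeting theorem of `GAN24/Monotone.lean` is this, applied to the producer's monotonicity statement. [folklore] -/
theorem betaAvgAFH_of_rows_monotoneTailUp (S : B12Beta.OneLoopSplit β) (c : Rows S.β0) (h : MonotoneTailUp S.β0 c.k₀) {γ₀ r : ℝ}
    (hrem : RemainderConst S γ₀ r) : BetaAvgAFH (((c.m₀ : ℚ) : ℝ) - r) 0 γ₀ β :=
  betaAvgAFH_of_betaLowerH (betaLowerH_of_floor_const S (floor_of_rows_monotoneTailUp c h) hrem)

/-- **END (M↓ + limit)**: rows + `MonotoneTailDown S.β0 k₀` + `Tendsto S.β0 atTop (𝓝 binf)` + constant remainder ⟹ `BetaAvgAFH (min m₀ binf − r) 0 γ₀ β`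
(positivity of the constant needs `binf > r`: the limit VALUE enters, the rows serve `k ≤ k₀` only). [folklore] -/
theorem betaAvgAFH_of_rows_monotoneTailDown (S : B12Beta.OneLoopSplit β) (c : Rows S.β0) {binf : ℝ} (h : MonotoneTailDown S.β0 c.k₀)
    (hlim : Tendsto S.β0 atTop (𝓝 binf)) {γ₀ r : ℝ} (hrem : RemainderConst S γ₀ r) :
    BetaAvgAFH (min ((c.m₀ : ℚ) : ℝ) binf - r) 0 γ₀ β :=
  betaAvgAFH_of_betaLowerH (betaLowerH_of_floor_const S (floor_of_rows_monotoneTailDown c h hlim) hrem)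

/-- **END (C)**: rows + `ContractingTail S.β0 binf θ k₀` (`0 ≤ θ ≤ 1`) + `|S.β0 k₀ − binf| ≤ D` + constant remainder ⟹
`BetaAvgAFH (min m₀ (binf − θ·D) − r) 0 γ₀ β` — the «CAP-certified k ≤ k₀ + contracting tail» road WITHOUT a sharp rate. [folklore] -/
theorem betaAvgAFH_of_rows_contractingTail (S : B12Beta.OneLoopSplit β) (c : Rows S.β0) {binf θ D : ℝ}
    (h : ContractingTail S.β0 binf θ c.k₀) (hθ0 : 0 ≤ θ) (hθ1 : θ ≤ 1) (hD : |S.β0 c.k₀ - binf| ≤ D) {γ₀ r : ℝ}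
    (hrem : RemainderConst S γ₀ r) : BetaAvgAFH (min ((c.m₀ : ℚ) : ℝ) (binf - θ * D) - r) 0 γ₀ β :=
  betaAvgAFH_of_betaLowerH (betaLowerH_of_floor_const S (floor_of_rows_contractingTail c h hθ0 hθ1 hD) hrem)

end Ends

/-! ## §4 Non-vacuity on the constant witness `β⁰ ≡ 1` (`CapRows.capRowsOne`) -/

open Beta.Assembly.Witness (splitOne)

/-- the constant sequence is a non-decreasing, non-increasing and contracting tail (towards `1`, any `θ ≥ 0`). [folklore] -/
theorem sockets_splitOne (θ : ℝ) :
    MonotoneTailUp splitOne.β0 0 ∧ MonotoneTailDown splitOne.β0 0 ∧ ContractingTail splitOne.β0 1 θ 0 := by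
  refine ⟨fun k _ => ?_, fun k _ => ?_, fun k _ => ?_⟩ <;>
    simp [Beta.Assembly.Witness.splitOne]

/-- the (M↑) floor on the witness is `1`. [folklore] -/
theorem floor_capRowsOne : ∀ k, ((capRowsOne.m₀ : ℚ) : ℝ) ≤ splitOne.β0 k :=
  floor_of_rows_monotoneTailUp capRowsOne (sockets_splitOne 0).1


/-! ## §5 (v1.1, APPEND-ONLY) The two-sided datum for (C) from cap3's `ℓ¹` aliasing leaf

`ContractingTail` needs ONE two-sided datum `|b k₀ − binf| ≤ D`.  For the `k₀ = 0` anchor the aliasing leaf is two-sided by nature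
(`AliasingTailL1.norm_torusKernel_zero_sub_latticeKernel_zero_le_l1` bounds a NORM), but only its lower half
`latticeKernel_zero_re_ge_l1` is exported there; here is the upper twin and the datum assembled from the same binders (N), (Z), (T), (A) as
`CapRows.Rows.ofAliasingL1` plus a rational enclosure `bl ≤ binf ≤ bh` of the limit value (a BINDER — the asymptotic lane's identification). -/

section Datum

open Beta.AliasingTailL1 (StripRegularC aliasConstL1 norm_torusKernel_zero_sub_latticeKernel_zero_le_l1)

variable {d : ℕ}

/-- upper twin of `AliasingTail.re_ge_of_enclosures`: `‖T − t‖ ≤ r` and `‖T − c‖ ≤ A` give `Re c ≤ t + r + A`. [folklore] -/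
theorem re_le_of_enclosures {T c : ℂ} {t r A : ℝ} (hT : ‖T - t‖ ≤ r) (hA : ‖T - c‖ ≤ A) : c.re ≤ t + r + A := by
  have h1 : |(T - (t : ℂ)).re| ≤ r := (Complex.abs_re_le_norm _).trans hT
  have h2 : |(T - c).re| ≤ A := (Complex.abs_re_le_norm _).trans hA
  simp only [Complex.sub_re, Complex.ofReal_re] at h1 h2
  have h1' := (abs_le.mp h1).2
  have h2' := (abs_le.mp h2).1
  linarith

/-- **UPPER HALF of the `ℓ¹` aliasing leaf**: `Re (latticeKernel G 0) ≤ t + r + M·aliasConstL1 κ N d` (twin of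
`AliasingTailL1.latticeKernel_zero_re_ge_l1`). [folklore] -/
theorem latticeKernel_zero_re_le_l1 {G : (Fin (d + 1) → ℂ) → ℂ} {κ M : ℝ} (h : StripRegularC G κ M) (hκ : 0 < κ)
    {N : ℕ} (hN : 1 ≤ N) {t r : ℝ}
    (hT : ‖B4TorusKernel.torusKernel (B4TorusKernel.descendC G (h.toStripRegular hκ.le) hκ.le) N 0 - t‖ ≤ r) :
    (B4ContourShift.latticeKernel G 0).re ≤ t + r + M * aliasConstL1 κ N d :=
  re_le_of_enclosures hT (norm_torusKernel_zero_sub_latticeKernel_zero_le_l1 h hκ hN)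

/-- **THE DATUM for (C) at `k₀ = 0`**: (N) `b 0 = Re (latticeKernel G 0)`, (Z), (T), (A) `M·aliasConstL1 κ N d ≤ A` and an enclosure
`bl ≤ binf ≤ bh` give `|b 0 − binf| ≤ max (t + r + A − bl) (bh − (t − r − A))` — the `hD` of `floor_of_rows_contractingTail` ∕
`betaAvgAFH_of_rows_contractingTail` for the anchor row `CapRows.Rows.ofAliasingL1` (whose `k₀ = 0`). [folklore] -/
theorem datum_of_aliasingL1 {b : ℕ → ℝ} {G : (Fin (d + 1) → ℂ) → ℂ} {κ M : ℝ}
    (hb : b 0 = (B4ContourShift.latticeKernel G 0).re) (h : StripRegularC G κ M) (hκ : 0 < κ) {N : ℕ} (hN : 1 ≤ N) {t r : ℝ}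
    (hT : ‖B4TorusKernel.torusKernel (B4TorusKernel.descendC G (h.toStripRegular hκ.le) hκ.le) N 0 - t‖ ≤ r)
    {A : ℝ} (hA : M * aliasConstL1 κ N d ≤ A) {binf bl bh : ℝ} (hbl : bl ≤ binf) (hbh : binf ≤ bh) :
    |b 0 - binf| ≤ max (t + r + A - bl) (bh - (t - r - A)) := by
  have hlo : t - r - A ≤ b 0 := by
    rw [hb]; have := Beta.AliasingTailL1.latticeKernel_zero_re_ge_l1 h hκ hN hT; linarith
  have hhi : b 0 ≤ t + r + A := by
    rw [hb]; have := latticeKernel_zero_re_le_l1 h hκ hN hT; linarith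
  exact abs_sub_le_of_enclosures hlo hhi hbl hbh

end Datum

/-! ## §6 (v1.2, APPEND-ONLY) The ONE-SHOT END of the contraction road at `k₀ = 0`

Everything the «CAP-certified k = 0 + contracting tail» road consumes, in one signature: the five anchor binders (N) (Z) (T) (A) cmp of
`CapRows.Rows.ofAliasingL1`, a rational enclosure of the limit value, the contraction socket from `k₀ = 0` with `0 ≤ θ ≤ 1`, and the
constant remainder (D4).  Output: the (R15) carrier with constant `min lo (binf − θ·D) − r`, `D = max (t + rT + A − bl) (bh − (t − rT − A))`.
gan24-p4's meeting theorem in `GAN24/Monotone.lean` is this with `hcontr` replaced by its discharge. [folklore] -/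

section OneShot

open Beta.AliasingTailL1 (StripRegularC aliasConstL1)

variable {β : HBeta} {d : ℕ}

/-- the anchor row's floor constant is its one entry: `(Rows.ofAliasingL1 …).m₀ = lo`. [folklore] -/
theorem ofAliasingL1_m₀ {b : ℕ → ℝ} {G : (Fin (d + 1) → ℂ) → ℂ} {κ M : ℝ} (hb : b 0 = (B4ContourShift.latticeKernel G 0).re)
    (h : StripRegularC G κ M) (hκ : 0 < κ) {N : ℕ} (hN : 1 ≤ N) {t r : ℝ}
    (hT : ‖B4TorusKernel.torusKernel (B4TorusKernel.descendC G (h.toStripRegular hκ.le) hκ.le) N 0 - t‖ ≤ r)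
    {A : ℝ} (hA : M * aliasConstL1 κ N d ≤ A) (lo : ℚ) (hlo : ((lo : ℚ) : ℝ) ≤ t - r - A) :
    (Rows.ofAliasingL1 hb h hκ hN hT hA lo hlo).m₀ = lo := by
  simp [Rows.m₀, Rows.ofAliasingL1]

/-- **ONE-SHOT END (contraction road, `k₀ = 0`)**: (N) level-0 dictionary + (Z) strip regularity + (T) two-engine torus ball at period `N` +
(A) tail majorant + `lo ≤ t − rT − A` + enclosure `bl ≤ binf ≤ bh` + `ContractingTail S.β0 binf θ 0` (`0 ≤ θ ≤ 1`) + `RemainderConst S γ₀ r`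
⟹ `BetaAvgAFH (min lo (binf − θ·max (t + rT + A − bl) (bh − (t − rT − A))) − r) 0 γ₀ β`.  NO rate constant, NO sharp `θ`. [folklore] -/
theorem betaAvgAFH_of_anchorL1_contracting (S : B12Beta.OneLoopSplit β) {G : (Fin (d + 1) → ℂ) → ℂ} {κ M : ℝ}
    (hb : S.β0 0 = (B4ContourShift.latticeKernel G 0).re) (h : StripRegularC G κ M) (hκ : 0 < κ) {N : ℕ} (hN : 1 ≤ N)
    {t rT : ℝ} (hT : ‖B4TorusKernel.torusKernel (B4TorusKernel.descendC G (h.toStripRegular hκ.le) hκ.le) N 0 - t‖ ≤ rT)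
    {A : ℝ} (hA : M * aliasConstL1 κ N d ≤ A) (lo : ℚ) (hlo : ((lo : ℚ) : ℝ) ≤ t - rT - A)
    {binf bl bh θ : ℝ} (hbl : bl ≤ binf) (hbh : binf ≤ bh) (hθ0 : 0 ≤ θ) (hθ1 : θ ≤ 1)
    (hcontr : ContractingTail S.β0 binf θ 0) {γ₀ r : ℝ} (hrem : RemainderConst S γ₀ r) :
    BetaAvgAFH (min ((lo : ℚ) : ℝ) (binf - θ * max (t + rT + A - bl) (bh - (t - rT - A))) - r) 0 γ₀ β := by
  have hD := datum_of_aliasingL1 hb h hκ hN hT hA hbl hbh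
  have key := betaAvgAFH_of_rows_contractingTail S (Rows.ofAliasingL1 hb h hκ hN hT hA lo hlo) hcontr hθ0 hθ1 hD hrem
  rwa [ofAliasingL1_m₀] at key

end OneShot

/-! ### Transport of the sockets along a full dictionary `∀ k, b k = T k` (the producer may prove its statement for a typed proxy `T`) -/

section Transport

variable {b T : ℕ → ℝ}

/-- (M↑) transports along `∀ k ≥ k₀, b k = T k`. [folklore] -/
theorem monotoneTailUp_congr {k₀ : ℕ} (hT : ∀ k, k₀ ≤ k → b k = T k) (h : MonotoneTailUp T k₀) : MonotoneTailUp b k₀ :=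
  fun k hk => by rw [hT k hk, hT (k + 1) (by omega)]; exact h k hk

/-- (M↓) transports along `∀ k ≥ k₀, b k = T k`. [folklore] -/
theorem monotoneTailDown_congr {k₀ : ℕ} (hT : ∀ k, k₀ ≤ k → b k = T k) (h : MonotoneTailDown T k₀) : MonotoneTailDown b k₀ :=
  fun k hk => by rw [hT k hk, hT (k + 1) (by omega)]; exact h k hk

/-- (C) transports along `∀ k ≥ k₀, b k = T k`. [folklore] -/
theorem contractingTail_congr {binf θ : ℝ} {k₀ : ℕ} (hT : ∀ k, k₀ ≤ k → b k = T k) (h : ContractingTail T binf θ k₀) :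
    ContractingTail b binf θ k₀ :=
  fun k hk => by rw [hT k hk, hT (k + 1) (by omega)]; exact h k hk

/-- (C) is monotone in the ratio: `θ ≤ θ'` ⟹ `ContractingTail b binf θ k₀ → ContractingTail b binf θ' k₀`. [folklore] -/
theorem ContractingTail.mono {binf θ θ' : ℝ} {k₀ : ℕ} (h : ContractingTail b binf θ k₀) (hθ : θ ≤ θ') :
    ContractingTail b binf θ' k₀ :=
  fun k hk => (h k hk).trans (mul_le_mul_of_nonneg_right hθ (abs_nonneg _))

/-- (C) from a later index: `k₀ ≤ k₁` ⟹ `ContractingTail b binf θ k₀ → ContractingTail b binf θ k₁`. [folklore] -/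
theorem ContractingTail.of_le {binf θ : ℝ} {k₀ k₁ : ℕ} (h : ContractingTail b binf θ k₀) (hk : k₀ ≤ k₁) :
    ContractingTail b binf θ k₁ :=
  fun k hk1 => h k (hk.trans hk1)

end Transport

end Summit.QuantumFields.BalabanUV.Beta.CapRowsTail
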